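import Mathlib
import Summits.Ventures.PercRepro2.FourTypedInert

/-!
# Four typed edges: the bridge lemmas (blind cell PercRepro2, night-3, 2026-08-24)

The generic pieces of the four-edge theorem: the count vanishes when the roots are joined in the
closed configuration (`typedCount_eq_zero_of_conn_closedOn`); an inert typed edge of a set of at
most four reduces to the landed three-edge theorem (`nonneg_of_inert`); the ends of the four typed
edges can be ORIENTED so that every first end carries the smaller label (`exists_oriented`); a
typed edge whose ends are joined in the closed configuration is inert (`nonneg_of_loop`).
-/

namespace Summit.Ventures.PercRepro2

open UnionCluster

namespace CovForm

namespace TwoTyped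

open OneTyped TypedRed

/-! ## Generic lemmas -/

section Bridge4

open Classical

variable {V : Type*} {E : Type*} [Fintype E] [DecidableEq E] {R : Type*} [Field R]
  [LinearOrder R] [IsStrictOrderedRing R]
variable (ends : E → Sym2 V) (o a₁ a₂ a₃ b : V)

omit [Fintype E] [LinearOrder R] [IsStrictOrderedRing R] in
/-- A configuration agreeing with `z` off `F` dominates the closed configuration. -/
lemma closedOn_le' {F : Finset E} {z x : Config E} (hx : ∀ e, e ∉ F → x e = z e) :
    closedOn F z ≤ x := by
  intro e'
  by_cases h : e' ∈ F
  · simp [closedOn, h]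
  · simp only [closedOn, h, if_false]
    rw [hx e' h]

omit [LinearOrder R] [IsStrictOrderedRing R] in
/-- If the roots are joined once the typed edges are closed, the typed count vanishes. -/
lemma typedCount_eq_zero_of_conn_closedOn (F : Finset E) (z : Config E) (τ : E → ℕ)
    (hQ : Conn ends (closedOn F z) a₂ a₁) :
    typedCount F z τ (K3 ends o a₁ a₂ a₃ b : Config E → Config E → Config E → R) = 0 := by
  unfold typedCount
  refine Finset.sum_eq_zero fun x _ => Finset.sum_eq_zero fun y _ => Finset.sum_eq_zero fun w _ => ?_
  split_ifs with h
  · exact K3_zero_x ends o a₁ a₂ a₃ b (conn_mono (closedOn_le' fun e he => (h.1 e he).1) hQ) y w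
  · rfl

/-- An inert typed edge of a set of at most four typed edges: the count is nonnegative by the
three-edge theorem. -/
lemma nonneg_of_inert (F : Finset E) (e : E) (he : e ∈ F) (hF : F.card ≤ 4) {z : Config E}
    {τ : E → ℕ} (hτ : ∀ e' ∈ F, τ e' = 1 ∨ τ e' = 2)
    (h : typedCount F z τ (K3 ends o a₁ a₂ a₃ b : Config E → Config E → Config E → R) =
      (Nat.choose 3 (τ e) : R) * typedCount F z (Function.update τ e 0) (K3 ends o a₁ a₂ a₃ b)) :
    0 ≤ typedCount F z τ (K3 ends o a₁ a₂ a₃ b : Config E → Config E → Config E → R) := by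
  rw [h, typedCount_type_zero F e he z _ (by simp)]
  refine mul_nonneg (Nat.cast_nonneg _) ?_
  refine typedCount_nonneg_of_card_le_three' ends o a₁ a₂ a₃ b (F.erase e) ?_ _ _ ?_
  · rw [Finset.card_erase_of_mem he]; omega
  · intro e' he'
    rw [Function.update_of_ne (Finset.ne_of_mem_erase he')]
    exact hτ e' (Finset.mem_of_mem_erase he')

omit [Fintype E] [DecidableEq E] in
/-- **Orientation of the four typed edges**: the ends can be named so that, in the
least-representative labelling of the thirteen points, every first end carries a label at most
that of the second end (`lab_orient`, edge by edge). -/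
lemma exists_oriented (e₁ e₂ e₃ e₄ : E) (z0 : Config E) :
    ∃ u₁ w₁ u₂ w₂ u₃ w₃ u₄ w₄ : V, ends e₁ = s(u₁, w₁) ∧ ends e₂ = s(u₂, w₂) ∧
      ends e₃ = s(u₃, w₃) ∧ ends e₄ = s(u₄, w₄) ∧
      lab ends o a₁ a₂ a₃ b [u₁, w₁, u₂, w₂, u₃, w₃, u₄, w₄] z0 5 ≤ lab ends o a₁ a₂ a₃ b [u₁, w₁, u₂, w₂, u₃, w₃, u₄, w₄] z0 6 ∧ lab ends o a₁ a₂ a₃ b [u₁, w₁, u₂, w₂, u₃, w₃, u₄, w₄] z0 7 ≤ lab ends o a₁ a₂ a₃ b [u₁, w₁, u₂, w₂, u₃, w₃, u₄, w₄] z0 8 ∧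
      lab ends o a₁ a₂ a₃ b [u₁, w₁, u₂, w₂, u₃, w₃, u₄, w₄] z0 9 ≤ lab ends o a₁ a₂ a₃ b [u₁, w₁, u₂, w₂, u₃, w₃, u₄, w₄] z0 10 ∧ lab ends o a₁ a₂ a₃ b [u₁, w₁, u₂, w₂, u₃, w₃, u₄, w₄] z0 11 ≤ lab ends o a₁ a₂ a₃ b [u₁, w₁, u₂, w₂, u₃, w₃, u₄, w₄] z0 12 := by
  obtain ⟨u₁, w₁, hends₁, ho₁⟩ : ∃ u w : V, ends e₁ = s(u, w) ∧
      lab ends o a₁ a₂ a₃ b [u, w] z0 5 ≤ lab ends o a₁ a₂ a₃ b [u, w] z0 6 := by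
    obtain ⟨⟨A, B⟩, hAB⟩ := Quot.exists_rep (ends e₁)
    rcases lab_orient ends o a₁ a₂ a₃ b [] A B z0 with h | h
    · exact ⟨A, B, hAB.symm, by simpa using h⟩
    · exact ⟨B, A, by rw [← hAB, Sym2.eq_swap], by simpa using h⟩
  obtain ⟨u₂, w₂, hends₂, ho₂⟩ : ∃ u w : V, ends e₂ = s(u, w) ∧
      lab ends o a₁ a₂ a₃ b [u₁, w₁, u, w] z0 7 ≤ lab ends o a₁ a₂ a₃ b [u₁, w₁, u, w] z0 8 := by
    obtain ⟨⟨A, B⟩, hAB⟩ := Quot.exists_rep (ends e₂)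
    rcases lab_orient ends o a₁ a₂ a₃ b [u₁, w₁] A B z0 with h | h
    · exact ⟨A, B, hAB.symm, by simpa using h⟩
    · exact ⟨B, A, by rw [← hAB, Sym2.eq_swap], by simpa using h⟩
  obtain ⟨u₃, w₃, hends₃, ho₃⟩ : ∃ u w : V, ends e₃ = s(u, w) ∧
      lab ends o a₁ a₂ a₃ b [u₁, w₁, u₂, w₂, u, w] z0 9 ≤ lab ends o a₁ a₂ a₃ b [u₁, w₁, u₂, w₂, u, w] z0 10 := by
    obtain ⟨⟨A, B⟩, hAB⟩ := Quot.exists_rep (ends e₃)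
    rcases lab_orient ends o a₁ a₂ a₃ b [u₁, w₁, u₂, w₂] A B z0 with h | h
    · exact ⟨A, B, hAB.symm, by simpa using h⟩
    · exact ⟨B, A, by rw [← hAB, Sym2.eq_swap], by simpa using h⟩
  obtain ⟨u₄, w₄, hends₄, ho₄⟩ : ∃ u w : V, ends e₄ = s(u, w) ∧
      lab ends o a₁ a₂ a₃ b [u₁, w₁, u₂, w₂, u₃, w₃, u, w] z0 11 ≤ lab ends o a₁ a₂ a₃ b [u₁, w₁, u₂, w₂, u₃, w₃, u, w] z0 12 := by
    obtain ⟨⟨A, B⟩, hAB⟩ := Quot.exists_rep (ends e₄)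
    rcases lab_orient ends o a₁ a₂ a₃ b [u₁, w₁, u₂, w₂, u₃, w₃] A B z0 with h | h
    · exact ⟨A, B, hAB.symm, by simpa using h⟩
    · exact ⟨B, A, by rw [← hAB, Sym2.eq_swap], by simpa using h⟩
  refine ⟨u₁, w₁, u₂, w₂, u₃, w₃, u₄, w₄, hends₁, hends₂, hends₃, hends₄, ?_, ?_, ?_, ho₄⟩
  · have e5 := lab_prefix ends o a₁ a₂ a₃ b [u₁, w₁] [u₁, w₁, u₂, w₂, u₃, w₃, u₄, w₄] z0 5 (fun j hj => by interval_cases j <;> rfl)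
    have e6 := lab_prefix ends o a₁ a₂ a₃ b [u₁, w₁] [u₁, w₁, u₂, w₂, u₃, w₃, u₄, w₄] z0 6 (fun j hj => by interval_cases j <;> rfl)
    rw [← e5, ← e6]; exact ho₁
  · have e7 := lab_prefix ends o a₁ a₂ a₃ b [u₁, w₁, u₂, w₂] [u₁, w₁, u₂, w₂, u₃, w₃, u₄, w₄] z0 7 (fun j hj => by interval_cases j <;> rfl)
    have e8 := lab_prefix ends o a₁ a₂ a₃ b [u₁, w₁, u₂, w₂] [u₁, w₁, u₂, w₂, u₃, w₃, u₄, w₄] z0 8 (fun j hj => by interval_cases j <;> rfl)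
    rw [← e7, ← e8]; exact ho₂
  · have e9 := lab_prefix ends o a₁ a₂ a₃ b [u₁, w₁, u₂, w₂, u₃, w₃] [u₁, w₁, u₂, w₂, u₃, w₃, u₄, w₄] z0 9 (fun j hj => by interval_cases j <;> rfl)
    have e10 := lab_prefix ends o a₁ a₂ a₃ b [u₁, w₁, u₂, w₂, u₃, w₃] [u₁, w₁, u₂, w₂, u₃, w₃, u₄, w₄] z0 10 (fun j hj => by interval_cases j <;> rfl)
    rw [← e9, ← e10]; exact ho₃

/-- **A typed edge with joined ends** (a loop of the closed configuration): the count is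
nonnegative by the inert-edge reduction and the three-edge theorem. -/
lemma nonneg_of_loop (e₁ e₂ e₃ e₄ : E) (z : Config E) (τ : E → ℕ)
    (hτ : ∀ e ∈ ({e₁, e₂, e₃, e₄} : Finset E), τ e = 1 ∨ τ e = 2) (z0 : Config E)
    (hz0c : closedOn ({e₁, e₂, e₃, e₄} : Finset E) z = z0) (u₁ w₁ u₂ w₂ u₃ w₃ u₄ w₄ : V)
    (hends₁ : ends e₁ = s(u₁, w₁)) (hends₂ : ends e₂ = s(u₂, w₂)) (hends₃ : ends e₃ = s(u₃, w₃))
    (hends₄ : ends e₄ = s(u₄, w₄))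
    (hl : lab ends o a₁ a₂ a₃ b [u₁, w₁, u₂, w₂, u₃, w₃, u₄, w₄] z0 5 = lab ends o a₁ a₂ a₃ b [u₁, w₁, u₂, w₂, u₃, w₃, u₄, w₄] z0 6 ∨ lab ends o a₁ a₂ a₃ b [u₁, w₁, u₂, w₂, u₃, w₃, u₄, w₄] z0 7 = lab ends o a₁ a₂ a₃ b [u₁, w₁, u₂, w₂, u₃, w₃, u₄, w₄] z0 8 ∨
      lab ends o a₁ a₂ a₃ b [u₁, w₁, u₂, w₂, u₃, w₃, u₄, w₄] z0 9 = lab ends o a₁ a₂ a₃ b [u₁, w₁, u₂, w₂, u₃, w₃, u₄, w₄] z0 10 ∨ lab ends o a₁ a₂ a₃ b [u₁, w₁, u₂, w₂, u₃, w₃, u₄, w₄] z0 11 = lab ends o a₁ a₂ a₃ b [u₁, w₁, u₂, w₂, u₃, w₃, u₄, w₄] z0 12) :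
    0 ≤ typedCount {e₁, e₂, e₃, e₄} z τ (K3 ends o a₁ a₂ a₃ b : Config E → Config E → Config E → R) := by
  rcases hl with hl | hl | hl | hl
  · refine nonneg_of_inert ends o a₁ a₂ a₃ b {e₁, e₂, e₃, e₄} e₁ (by simp) (Finset.card_le_four) hτ ?_
    refine typedCount_inert_of_conn ends o a₁ a₂ a₃ b {e₁, e₂, e₃, e₄} e₁ (by simp) hends₁ z τ ?_
    rw [hz0c]
    exact (lab_eq_iff ends o a₁ a₂ a₃ b [u₁, w₁, u₂, w₂, u₃, w₃, u₄, w₄] z0 5 6).mp hl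
  · refine nonneg_of_inert ends o a₁ a₂ a₃ b {e₁, e₂, e₃, e₄} e₂ (by simp) (Finset.card_le_four) hτ ?_
    refine typedCount_inert_of_conn ends o a₁ a₂ a₃ b {e₁, e₂, e₃, e₄} e₂ (by simp) hends₂ z τ ?_
    rw [hz0c]
    exact (lab_eq_iff ends o a₁ a₂ a₃ b [u₁, w₁, u₂, w₂, u₃, w₃, u₄, w₄] z0 7 8).mp hl
  · refine nonneg_of_inert ends o a₁ a₂ a₃ b {e₁, e₂, e₃, e₄} e₃ (by simp) (Finset.card_le_four) hτ ?_
    refine typedCount_inert_of_conn ends o a₁ a₂ a₃ b {e₁, e₂, e₃, e₄} e₃ (by simp) hends₃ z τ ?_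
    rw [hz0c]
    exact (lab_eq_iff ends o a₁ a₂ a₃ b [u₁, w₁, u₂, w₂, u₃, w₃, u₄, w₄] z0 9 10).mp hl
  · refine nonneg_of_inert ends o a₁ a₂ a₃ b {e₁, e₂, e₃, e₄} e₄ (by simp) (Finset.card_le_four) hτ ?_
    refine typedCount_inert_of_conn ends o a₁ a₂ a₃ b {e₁, e₂, e₃, e₄} e₄ (by simp) hends₄ z τ ?_
    rw [hz0c]
    exact (lab_eq_iff ends o a₁ a₂ a₃ b [u₁, w₁, u₂, w₂, u₃, w₃, u₄, w₄] z0 11 12).mp hl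

end Bridge4

end TwoTyped

end CovForm

end Summit.Ventures.PercRepro2
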